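import Summits.SmoothPoincare4.SmoothPoincare4.Theses.ConvexBisection
import Summits.SmoothPoincare4.SmoothPoincare4.Theorems.AcyclicBisectionExists.Negative.TwistedDoubles
import Summits.SmoothPoincare4.SmoothPoincare4.Theorems.AcyclicBisectionExists.Negative.OneSided
import Literature.Topology.FourManifolds.Gluing
import Literature.Geometry.Symplectic.PlanarContactBoundary
import Literature.Geometry.Symplectic.SteinDomain
import Literature.AlgebraicTopology.SingularHomology.SingularChains

/-!
# drefute gen 2 — candidate proof of the r4 stub `stub_glueWitness` (line `modp-braid-orbits`,
crux stmt-SmoothPoincare4-10508), EVIDENCE ONLY (a refuter does not land positive stubs).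

The registered signature of `stub_glueWitness` (skeleton r4, sha 707534b5…, 2026-08-16T03:08Z) is
closed by the two landed negative-side lemmas exactly as its docstring says:
`Negative.Witness.ofTwistedGlue` (Negative/TwistedDoubles.lean, p74628) gives the witness with
`W₁ := W₁`, and `Negative.Witness.acyclicRight_of_acyclicLeft_of_homotopyEquiv'`
(Negative/OneSided.lean, p71244) gives acyclicity of the right half; the only glue is
`Nonempty M` from `M ≃ₕ S⁴` (as in the landed `stub_acyclicRight`, p72264).
-/

noncomputable section

set_option linter.dupNamespace false

open scoped Manifold ContDiff Topology ContinuousMap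

namespace Summit.SmoothPoincare4.SmoothPoincare4.Cruxes.AcyclicBisectionExists.DrefuteGen2

open Literature.Topology.FourManifolds (BoundaryData IsBoundaryGluing)
open Literature.Geometry.Symplectic (SteinStructure contactPlane boundaryPlaneField)
open Literature.AlgebraicTopology.SingularHomology (singularHomology)
open Summit.SmoothPoincare4.SmoothPoincare4.Theorems.AcyclicBisectionExists.Negative
  (Witness HasAcyclicSteinBisection)

/-- The r4 stub `stub_glueWitness`, verbatim signature, proved from the landed `Negative/*` lemmas.
[folklore] -/
theorem stub_glueWitness_candidate :
    ∀ (M : Type) [TopologicalSpace M] [T2Space M] [SecondCountableTopology M]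
      [ChartedSpace (EuclideanSpace ℝ (Fin 4)) M] [IsManifold (𝓡 4) ∞ M],
      M ≃ₕ Metric.sphere (0 : EuclideanSpace ℝ (Fin 5)) 1 →
      ∀ (W₁ : Type) [TopologicalSpace W₁] [ChartedSpace (EuclideanHalfSpace 4) W₁]
        [IsManifold (𝓡∂ 4) ∞ W₁] [CompactSpace W₁]
        (W₂ : Type) [TopologicalSpace W₂] [ChartedSpace (EuclideanHalfSpace 4) W₂]
        [IsManifold (𝓡∂ 4) ∞ W₂] [CompactSpace W₂]
        (S₁ : SteinStructure W₁) (S₂ : SteinStructure W₂)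
        (b₁ : BoundaryData (𝓡∂ 4) W₁ (𝓡 3)) (b₂ : BoundaryData (𝓡∂ 4) W₂ (𝓡 3))
        (ψ : b₁.carrier ≃ₘ⟮𝓡 3, 𝓡 3⟯ b₂.carrier),
        (∀ z, Submodule.map (mfderiv (𝓡 3) (𝓡∂ 4) (b₂.incl ∘ ψ) z).toLinearMap
            (boundaryPlaneField S₁.J b₁ z) = contactPlane S₂.J (b₂.incl (ψ z))) →
        IsBoundaryGluing b₁ b₂ ψ (𝓡 4) M →
        ConnectedSpace W₁ →
        (∀ k, 0 < k → CategoryTheory.Limits.IsZero (singularHomology ℚ ℚ W₁ k)) →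
        HasAcyclicSteinBisection M := by
  intro M _ _ _ _ _ e W₁ _ _ _ _ W₂ _ _ _ _ S₁ S₂ b₁ b₂ ψ hψ hglue hconn hac
  let B : Witness M := Witness.ofTwistedGlue b₁ b₂ S₁ S₂ ψ hψ hglue
  haveI : Nonempty M := ⟨e.invFun ⟨EuclideanSpace.single 0 1, by simp⟩⟩
  haveI : ConnectedSpace B.W₁ := hconn
  have hL : B.AcyclicLeft := hac
  exact ⟨B, (B.acyclic_iff).2 ⟨hL, B.acyclicRight_of_acyclicLeft_of_homotopyEquiv' e hL⟩⟩

end Summit.SmoothPoincare4.SmoothPoincare4.Cruxes.AcyclicBisectionExists.DrefuteGen2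

end
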